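import Summits.BirchSwinnertonDyer.BirchSwinnertonDyer.Theorems.ByReductionTypeAtTwoFineSelmerConjAAtTwoAdditivePotGoodTwoLayerDoorEvenIndex
import Summits.BirchSwinnertonDyer.BirchSwinnertonDyer.Theorems.ByReductionTypeAtTwoFineSelmerConjAAtTwoAdditivePotGoodClassNumberOne780
import HarnessLib

/-!
# Route `ByReductionTypeAtTwo` (rung K4), crux C1″ `FineSelmerConjAAtTwoAdditivePotGood` (item stmt-BirchSwinnertonDyer-22615):
# TWO-LAYER STAMPS, EVEN-INDEX TYPE `2 = 𝔭²𝔮`, part B — the two census rows `244416cn1` and `434964b1` whose `2`-torsion cubic field is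
# the complex cubic field of discriminant `−804`: `h = 1` by an explicit Minkowski certificate (kernel), Fukuda's index `0` by an
# even-index certificate (kernel), hence (A)₂ modulo `hLim2` and ONE displayed bit — the parity of `h(F(√2))` (census: `Cl(F(√2)) = []`)
# (a `--supports 22615` file; seat `bsd-2adic-k4-w1` GEN 5; sequel of `…TwoLayerStampsEvenIndexA`)

HONEST FRAMING (cell `bsd-2adic`, D-0036/D-0054/D-0152): per-class stamps; conditional on `hLim2` BY NAME and on ONE displayed bit per row,
«`e_1 = 0` along the cyclotomic `ℤ₂`-extensions of `ℚ(θ)`» = `2 ∤ h(ℚ(θ, √2))` (census `cyc6 = []`, PARI — NOT kernel). KERNEL: irreducibility,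
`h(ℚ(θ)) = 1`, `ℚ(P) = ℚ(θ)` per row, the even-index certificate, Fukuda's index `0` and Thm. 1 (1). Closes nothing at the `∀`-level;
nothing booked; BSD is not proved by any of this. BOTH ROWS LEAVE `C1″-RES` FOR THE DOOR SIDE.

THE FIELD `d = −804 = −4·3·67`: `ℚ(θ)`, `θ³ − θ² + 4θ − 6 = 0` (no root mod `5`: irreducible); `2 = 𝔭²𝔮` (`X²(X + 1) mod 2`), `3 = 𝔭₃²𝔮₃`
(`X(X + 1)² mod 3`). CERTIFICATE (`M < 9`): norm `2`: `θ ≡ 0`: `α = 3θ − 4`, `N = 2`; `θ ≡ 1`: `α = θ − 1`, `N = 2`; norm `3`: `θ ≡ 0`: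
`α = 2θ² + 4θ − 9 = θ(2θ + 4) − 9`, `N = −3`; `θ ≡ 2`: `α = 5θ² − 3θ − 5 = (θ − 2)(5θ + 7) + 9`, `N = 3`; norms `5, 7`: no root; `6`: not a
prime power; norms `4, 8`: `2 ∈ I` and `θ·θ·(θ − 1) = 2(3 − 2θ)` put a norm-`2` element in `I`.

References: [Fukuda1994] Thm. 1 (1); [Lim2017FineSelmer] Thm. 3.5, Lemma 3.2; [CoatesSujatha2005] (A); [Marcus1977] Ch. 5 Thm. 37;
[Cohen1993] App. B (d = −804: h = 1); cell TSV `addL2x/gen5/conjA2_census_j289938_classes.tsv` (rows 244416cn1, 434964b1).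
-/

set_option autoImplicit false
-- sibling precedent (`…TwoLayerDoorEvenIndex.lean`): the directory name repeats the summit name
set_option linter.dupNamespace false

noncomputable section

open scoped Classical IntermediateField NumberField Real nonZeroDivisors

namespace Summit.BirchSwinnertonDyer.BirchSwinnertonDyer.Theorems.AddKatoTwo

open WeierstrassCurve Field Polynomial IsDedekindDomain NumberField Matrix Literature.NumberTheory.EllipticCurves
  Literature.NumberTheory.GaloisRepresentations
  Literature.NumberTheory.IwasawaTheory
  Summit.BirchSwinnertonDyer.BirchSwinnertonDyer.Theorems.AlignedTransportAtTwoTorsionPointField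
  Summit.BirchSwinnertonDyer.BirchSwinnertonDyer.Theses.ByReductionTypeAtTwo

/-! ## §1 The field of discriminant `−804` (`X³ − X² + 4X − 6`): class number one -/

/-- `X³ − X² + 4X − 6` is irreducible over `ℚ` (no root mod `5`). -/
theorem irreducible_cubic_d804n : Irreducible (Cubic.toPoly ⟨1, ((-1 : ℤ) : ℚ), ((4 : ℤ) : ℚ), ((-6 : ℤ) : ℚ)⟩) :=
  haveI : Fact (Nat.Prime 5) := ⟨by norm_num⟩
  irreducible_cubic_of_no_root_zmod 5 (by decide)

section Cert804

variable (K : Type) [Field K] [NumberField K]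

/-- Norms of `3θ − 4`, `θ − 1`, `2θ² + 4θ − 9`, `5θ² − 3θ − 5` in the field of `X³ − X² + 4X − 6`: `2, 2, −3, 3`. -/
private theorem dets_d804n :
    (((-4 : ℤ) : ℚ) • (1 : Matrix (Fin 3) (Fin 3) ℚ) + ((3 : ℤ) : ℚ) • !![(0 : ℚ), 0, -(-6 : ℤ); 1, 0, -(4 : ℤ); 0, 1, -(-1 : ℤ)] +
        ((0 : ℤ) : ℚ) • !![(0 : ℚ), 0, -(-6 : ℤ); 1, 0, -(4 : ℤ); 0, 1, -(-1 : ℤ)] ^ 2).det = 2 ∧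
    (((-1 : ℤ) : ℚ) • (1 : Matrix (Fin 3) (Fin 3) ℚ) + ((1 : ℤ) : ℚ) • !![(0 : ℚ), 0, -(-6 : ℤ); 1, 0, -(4 : ℤ); 0, 1, -(-1 : ℤ)] +
        ((0 : ℤ) : ℚ) • !![(0 : ℚ), 0, -(-6 : ℤ); 1, 0, -(4 : ℤ); 0, 1, -(-1 : ℤ)] ^ 2).det = 2 ∧
    (((-9 : ℤ) : ℚ) • (1 : Matrix (Fin 3) (Fin 3) ℚ) + ((4 : ℤ) : ℚ) • !![(0 : ℚ), 0, -(-6 : ℤ); 1, 0, -(4 : ℤ); 0, 1, -(-1 : ℤ)] +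
        ((2 : ℤ) : ℚ) • !![(0 : ℚ), 0, -(-6 : ℤ); 1, 0, -(4 : ℤ); 0, 1, -(-1 : ℤ)] ^ 2).det = -3 ∧
    (((-5 : ℤ) : ℚ) • (1 : Matrix (Fin 3) (Fin 3) ℚ) + ((-3 : ℤ) : ℚ) • !![(0 : ℚ), 0, -(-6 : ℤ); 1, 0, -(4 : ℤ); 0, 1, -(-1 : ℤ)] +
        ((5 : ℤ) : ℚ) • !![(0 : ℚ), 0, -(-6 : ℤ); 1, 0, -(4 : ℤ); 0, 1, -(-1 : ℤ)] ^ 2).det = 3 := by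
  refine ⟨?_, ?_, ?_, ?_⟩ <;>
    · simp only [Matrix.one_fin_three, Matrix.det_fin_three, Matrix.add_apply, Matrix.smul_apply, sq, Matrix.mul_apply,
      Fin.sum_univ_three, Matrix.of_apply, Matrix.cons_val', Matrix.cons_val_zero, Matrix.cons_val_one, Matrix.cons_val_two,
      Matrix.head_cons, Matrix.tail_cons, Matrix.empty_val', Matrix.cons_val_fin_one, smul_eq_mul]; norm_num

/-- **`h = 1` for every cubic number field containing a root of `X³ − X² + 4X − 6`** (the complex cubic field of discriminant `−804`),
by the explicit Minkowski certificate of the module docstring. KERNEL. [cite: Marcus1977, Ch. 5 Thm. 37 and Cor. 2]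
[cite: Cohen1993, App. B (complex cubic fields: d = −804, h = 1)] -/
theorem classNumber_eq_one_of_root_d804n (h3 : Module.finrank ℚ K = 3) (b : 𝓞 K)
    (hb : b ^ 3 + (-1 : ℤ) * b ^ 2 + (4 : ℤ) * b + (-6 : ℤ) = 0) : NumberField.classNumber K = 1 := by
  have hirr := irreducible_cubic_d804n
  have hd : |NumberField.discr K| ≤ (804 : ℕ) :=
    (abs_discr_le_abs_cubic_discr K h3 b hirr hb).trans (by simp only [Cubic.discr]; norm_num)
  have hM := minkowskiBound_lt_of_sqrt_le K h3 hd (s := 28.36) (B := 9)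
    ((Real.sqrt_le_sqrt (by norm_num : ((804 : ℕ) : ℝ) ≤ (28.36 : ℝ) ^ 2)).trans (Real.sqrt_sq (by norm_num)).le)
    (by norm_num)
  obtain ⟨hN2a, hN2b, hN3a, hN3b⟩ := dets_d804n
  have hb' : b ^ 3 - b ^ 2 + 4 * b - 6 = 0 := by push_cast at hb; linear_combination hb
  rw [NumberField.classNumber_eq_one_iff]
  refine RingOfIntegers.isPrincipalIdealRing_of_isPrincipal_of_norm_le_of_isPrime fun I hI hle ↦ ?_
  have hlt : Ideal.absNorm (I : Ideal (𝓞 K)) < 9 := by exact_mod_cast hle.trans_lt hM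
  have h0 : Ideal.absNorm (I : Ideal (𝓞 K)) ≠ 0 := Ideal.absNorm_ne_zero_of_nonZeroDivisors I
  have h1 : Ideal.absNorm (I : Ideal (𝓞 K)) ≠ 1 := by rw [Ne, Ideal.absNorm_eq_one_iff]; exact hI.ne_top
  have hmemN := Ideal.absNorm_mem (I : Ideal (𝓞 K))
  have nα2a := natAbs_norm_coords_eq K h3 b hirr hb (-4) 3 0 (n := 2) hN2a (by norm_num)
  have nα2b := natAbs_norm_coords_eq K h3 b hirr hb (-1) 1 0 (n := 2) hN2b (by norm_num)
  have nα3a := natAbs_norm_coords_eq K h3 b hirr hb (-9) 4 2 (n := 3) hN3a (by norm_num)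
  have nα3b := natAbs_norm_coords_eq K h3 b hirr hb (-5) (-3) 5 (n := 3) hN3b (by norm_num)
  -- norm-2 elements from `2 ∈ I` and (`θ ∈ I` or `θ − 1 ∈ I`)
  have keya : ((2 : ℕ) : 𝓞 K) ∈ (I : Ideal (𝓞 K)) → b ∈ (I : Ideal (𝓞 K)) →
      (((-4 : ℤ) : 𝓞 K) + ((3 : ℤ) : 𝓞 K) * b + ((0 : ℤ) : 𝓞 K) * b ^ 2) ∈ (I : Ideal (𝓞 K)) := by
    intro h2 h
    have : (((-4 : ℤ) : 𝓞 K) + ((3 : ℤ) : 𝓞 K) * b + ((0 : ℤ) : 𝓞 K) * b ^ 2) = b * 3 + ((2 : ℕ) : 𝓞 K) * (-2) := by push_cast; ring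
    rw [this]; exact Ideal.add_mem _ (Ideal.mul_mem_right _ _ h) (Ideal.mul_mem_right _ _ h2)
  have keyb : b - 1 ∈ (I : Ideal (𝓞 K)) → (((-1 : ℤ) : 𝓞 K) + ((1 : ℤ) : 𝓞 K) * b + ((0 : ℤ) : 𝓞 K) * b ^ 2) ∈ (I : Ideal (𝓞 K)) := by
    intro h; have : (((-1 : ℤ) : 𝓞 K) + ((1 : ℤ) : 𝓞 K) * b + ((0 : ℤ) : 𝓞 K) * b ^ 2) = b - 1 := by push_cast; ring
    rw [this]; exact h
  -- `2 ∈ I` ⟹ a norm-`2` element lies in `I` (`θ·θ·(θ − 1) = 2(3 − 2θ)`)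
  have htwo : ((2 : ℕ) : 𝓞 K) ∈ (I : Ideal (𝓞 K)) → ∃ α ∈ (I : Ideal (𝓞 K)), (Algebra.norm ℤ α).natAbs = 2 := by
    intro h2
    have hprod : b * (b * (b - 1)) ∈ (I : Ideal (𝓞 K)) := by
      have : b * (b * (b - 1)) = ((2 : ℕ) : 𝓞 K) * (3 - 2 * b) := by push_cast; linear_combination hb'
      rw [this]; exact Ideal.mul_mem_right _ _ h2
    rcases hI.mem_or_mem hprod with h | h
    · exact ⟨_, keya h2 h, nα2a⟩
    rcases hI.mem_or_mem h with h | h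
    · exact ⟨_, keya h2 h, nα2a⟩
    · exact ⟨_, keyb h, nα2b⟩
  have h2le : 2 ≤ Ideal.absNorm (I : Ideal (𝓞 K)) := by omega
  interval_cases hn : Ideal.absNorm (I : Ideal (𝓞 K))
  · -- N(I) = 2
    have h2 : ((2 : ℕ) : 𝓞 K) ∈ (I : Ideal (𝓞 K)) := hmemN
    obtain ⟨a, ha, hab⟩ := exists_sub_natCast_mem_of_absNorm_eq_prime K (by norm_num) hn b
    interval_cases a
    · exact ⟨⟨_, eq_span_singleton_of_mem_of_absNorm_eq K two_ne_zero hn (keya h2 (by simpa using hab)) nα2a⟩⟩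
    · exact ⟨⟨_, eq_span_singleton_of_mem_of_absNorm_eq K two_ne_zero hn (keyb (by simpa using hab)) nα2b⟩⟩
  · -- N(I) = 3
    have h3m : ((3 : ℕ) : 𝓞 K) ∈ (I : Ideal (𝓞 K)) := hmemN
    obtain ⟨a, ha, hab⟩ := exists_sub_natCast_mem_of_absNorm_eq_prime K (by norm_num) hn b
    have hdvd := natCast_dvd_of_sub_mem K (by norm_num) hn h3 hb hab
    interval_cases a
    · refine ⟨⟨_, eq_span_singleton_of_mem_of_absNorm_eq K (by norm_num) hn ?_ nα3a⟩⟩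
      have : (((-9 : ℤ) : 𝓞 K) + ((4 : ℤ) : 𝓞 K) * b + ((2 : ℤ) : 𝓞 K) * b ^ 2) =
          (b - ((0 : ℕ) : 𝓞 K)) * (2 * b + 4) + ((3 : ℕ) : 𝓞 K) * (-3) := by push_cast; ring
      rw [this]; exact Ideal.add_mem _ (Ideal.mul_mem_right _ _ hab) (Ideal.mul_mem_right _ _ h3m)
    · norm_num at hdvd
    · refine ⟨⟨_, eq_span_singleton_of_mem_of_absNorm_eq K (by norm_num) hn ?_ nα3b⟩⟩
      have : (((-5 : ℤ) : 𝓞 K) + ((-3 : ℤ) : 𝓞 K) * b + ((5 : ℤ) : 𝓞 K) * b ^ 2) =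
          (b - ((2 : ℕ) : 𝓞 K)) * (5 * b + 7) + ((3 : ℕ) : 𝓞 K) * 3 := by push_cast; ring
      rw [this]; exact Ideal.add_mem _ (Ideal.mul_mem_right _ _ hab) (Ideal.mul_mem_right _ _ h3m)
  · -- N(I) = 4
    exfalso
    have h4 : ((4 : ℕ) : 𝓞 K) ∈ (I : Ideal (𝓞 K)) := hmemN
    have h2 : ((2 : ℕ) : 𝓞 K) ∈ (I : Ideal (𝓞 K)) := by
      have : ((4 : ℕ) : 𝓞 K) = ((2 : ℕ) : 𝓞 K) * ((2 : ℕ) : 𝓞 K) := by push_cast; norm_num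
      rw [this] at h4; exact (hI.mem_or_mem h4).elim id id
    obtain ⟨α, hα, hNα⟩ := htwo h2
    have hdvd := Ideal.absNorm_dvd_absNorm_of_le ((Ideal.span_singleton_le_iff_mem _).mpr hα)
    rw [Ideal.absNorm_span_singleton, hNα, hn] at hdvd
    omega
  · -- N(I) = 5: impossible
    exfalso
    obtain ⟨a, ha, hab⟩ := exists_sub_natCast_mem_of_absNorm_eq_prime K (by norm_num) hn b
    have hdvd := natCast_dvd_of_sub_mem K (by norm_num) hn h3 hb hab
    interval_cases a <;> norm_num at hdvd
  · -- N(I) = 6: impossible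
    exfalso
    have h6 : ((6 : ℕ) : 𝓞 K) ∈ (I : Ideal (𝓞 K)) := hmemN
    have : ((6 : ℕ) : 𝓞 K) = ((2 : ℕ) : 𝓞 K) * ((3 : ℕ) : 𝓞 K) := by push_cast; norm_num
    rw [this] at h6
    rcases hI.mem_or_mem h6 with h | h
    · have := absNorm_dvd_pow_three_of_natCast_mem K h3 h; rw [hn] at this; omega
    · have := absNorm_dvd_pow_three_of_natCast_mem K h3 h; rw [hn] at this; omega
  · -- N(I) = 7: impossible
    exfalso
    obtain ⟨a, ha, hab⟩ := exists_sub_natCast_mem_of_absNorm_eq_prime K (by norm_num) hn b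
    have hdvd := natCast_dvd_of_sub_mem K (by norm_num) hn h3 hb hab
    interval_cases a <;> norm_num at hdvd
  · -- N(I) = 8
    exfalso
    have h8 : ((8 : ℕ) : 𝓞 K) ∈ (I : Ideal (𝓞 K)) := hmemN
    have h2 : ((2 : ℕ) : 𝓞 K) ∈ (I : Ideal (𝓞 K)) := by
      have : ((8 : ℕ) : 𝓞 K) = ((2 : ℕ) : 𝓞 K) * (((2 : ℕ) : 𝓞 K) * ((2 : ℕ) : 𝓞 K)) := by push_cast; norm_num
      rw [this] at h8
      rcases hI.mem_or_mem h8 with h | h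
      · exact h
      · exact (hI.mem_or_mem h).elim id id
    obtain ⟨α, hα, hNα⟩ := htwo h2
    have hdvd := Ideal.absNorm_dvd_absNorm_of_le ((Ideal.span_singleton_le_iff_mem _).mpr hα)
    rw [Ideal.absNorm_span_singleton, hNα, hn] at hdvd
    omega

end Cert804

/-- `#Cl(𝓞 ℚ(θ)) = 1` for every root `θ` of `X³ − X² + 4X − 6`. KERNEL. [cite: Cohen1993, App. B (d = −804)] -/
theorem card_classGroup_adjoin_eq_one_disc_neg804 {θ : AlgebraicClosure ℚ}
    (hθ : aeval θ (Cubic.toPoly ⟨1, ((-1 : ℤ) : ℚ), ((4 : ℤ) : ℚ), ((-6 : ℤ) : ℚ)⟩) = 0) :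
    Nat.card (ClassGroup (𝓞 (IntermediateField.adjoin ℚ {θ}))) = 1 := by
  have hfm : (Cubic.toPoly ⟨1, ((-1 : ℤ) : ℚ), ((4 : ℤ) : ℚ), ((-6 : ℤ) : ℚ)⟩).Monic := Cubic.monic_of_a_eq_one'
  have hθint : IsIntegral ℚ θ := ⟨_, hfm, by rwa [← aeval_def]⟩
  haveI : FiniteDimensional ℚ (IntermediateField.adjoin ℚ {θ}) := IntermediateField.adjoin.finiteDimensional hθint
  haveI : NumberField (IntermediateField.adjoin ℚ {θ}) := NumberField.mk
  obtain ⟨b, -, hb⟩ := exists_ringOfIntegers_cubic_root (p := -1) (q := 4) (r := -6) hθ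
  have h1 := classNumber_eq_one_of_root_d804n _ (finrank_adjoin_eq_three_of_irreducible irreducible_cubic_d804n hθ) b hb
  rw [NumberField.classNumber, ← Nat.card_eq_fintype_card] at h1
  exact h1

/-! ## §2 The stamps -/

/-- The census curve `244416cn1` is an elliptic curve. -/
theorem isElliptic_244416cn1' : (⟨0, ((1 : ℤ) : ℚ), 0, ((-4424231585 : ℤ) : ℚ), ((-113268864408513 : ℤ) : ℚ)⟩ : WeierstrassCurve ℚ).IsElliptic :=
  isElliptic_cubicModel _ _ _ (by simp only [Cubic.discr]; norm_num)

/-- **(A)₂ for `244416cn1` from ONE parity bit** (a `C1″-RES` row of GEN 4's census: `2 = 𝔭²𝔮` in `ℚ(P)`, `d = -804`). Granted `hLim2`;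
displayed: «`e_1 = 0` along the cyclotomic `ℤ₂`-extensions of `ℚ(θ)`» = `2 ∤ h(ℚ(θ, √2))` (census `cyc6 = []`); `h(ℚ(θ)) = 1` by the kernel certificate `card_classGroup_adjoin_eq_one_disc_neg804`.
`θ` is any root of `X³ + (-1)X² + (4)X + (-6)`; KERNEL: `ℚ(P) = ℚ(β) = ℚ(θ)` (`β = 37959 + (5892)θ + (17110)θ²` is a root of the
`2`-division cubic), Fukuda's index `0` by the EVEN-INDEX CERTIFICATE `u = [-2, -2, 0]`, `v = [0, -1, -1]`, `m = [-8, 5, 1]`, `m' = [65, -59, 8]`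
(coordinates in `1, θ, θ²`; `N(2 − m'³) = 12649572874794`, `8 ∤`), Fukuda Thm. 1 (1).
[cite: Lim2017FineSelmer, §3 Thm. 3.5 and Lemma 3.2] [cite: Fukuda1994, Thm. 1 (1), p. 264] -/
theorem conjA_two_244416cn1_of_layerOneBit
    (hLim2 : Lim2017.thm35_at_two_fineSelmerDual_moduleFinite_of_classicalMuVanishes_of_le_divisionField_four)
    {θ : AlgebraicClosure ℚ} (hθ : aeval θ (Cubic.toPoly ⟨1, ((-1 : ℤ) : ℚ), ((4 : ℤ) : ℚ), ((-6 : ℤ) : ℚ)⟩) = 0)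
    (h1 : haveI : FiniteDimensional ℚ (IntermediateField.adjoin ℚ {θ}) :=
        IntermediateField.adjoin.finiteDimensional ((AlgebraicClosure.isAlgebraic ℚ).isAlgebraic θ).isIntegral
      haveI : NumberField (IntermediateField.adjoin ℚ {θ}) := NumberField.mk
      ∀ κL : ZpExtension (IntermediateField.adjoin ℚ {θ}) 2, κL.IsCyclotomic → classNumberPExp κL 1 = 0)
    (κ : ZpExtension ℚ 2) (hκ : κ.IsCyclotomic) :
    haveI := isElliptic_244416cn1'
    ∃ (γ : absoluteGaloisGroup ℚ) (D : (⟨0, ((1 : ℤ) : ℚ), 0, ((-4424231585 : ℤ) : ℚ), ((-113268864408513 : ℤ) : ℚ)⟩ : WeierstrassCurve ℚ).FineSelmerDualData κ γ),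
      Module.Finite ℤ_[2] (RestrictScalars ℤ_[2] (IwasawaAlgebra 2) D.X) := by
  haveI := isElliptic_244416cn1'
  have hθ' : θ ^ 3 + (-1 : AlgebraicClosure ℚ) * θ ^ 2 + (4 : AlgebraicClosure ℚ) * θ + (-6 : AlgebraicClosure ℚ) = 0 := by
    have := hθ
    simp only [Cubic.toPoly, map_one, one_mul, aeval_add, aeval_mul, aeval_C, aeval_X_pow, aeval_X,
      eq_ratCast, Rat.cast_intCast] at this
    push_cast at this
    linear_combination this
  set β : AlgebraicClosure ℚ := algebraMap ℚ (AlgebraicClosure ℚ) (37959 : ℚ) +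
      algebraMap ℚ (AlgebraicClosure ℚ) (5892 : ℚ) * θ + algebraMap ℚ (AlgebraicClosure ℚ) (17110 : ℚ) * θ ^ 2 with hβdef
  have hβ : aeval β (Cubic.toPoly ⟨1, ((1 : ℤ) : ℚ), ((-4424231585 : ℤ) : ℚ), ((-113268864408513 : ℤ) : ℚ)⟩) = 0 := by
    simp only [Cubic.toPoly, map_one, one_mul, aeval_add, aeval_mul, aeval_C, aeval_X_pow, aeval_X, eq_ratCast,
      Rat.cast_intCast]
    rw [hβdef]
    simp only [eq_ratCast]
    push_cast
    linear_combination ((37752041782128 : AlgebraicClosure ℚ) + (25267699503520 : AlgebraicClosure ℚ) * θ + (10183674550600 : AlgebraicClosure ℚ) * θ ^ 2 + (5008988431000 : AlgebraicClosure ℚ) * θ ^ 3) * hθ'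
  have hadj : IntermediateField.adjoin ℚ {β} = IntermediateField.adjoin ℚ {θ} := by
    apply le_antisymm
    · rw [IntermediateField.adjoin_simple_le_iff, hβdef]
      have hθmem := IntermediateField.mem_adjoin_simple_self ℚ θ
      exact add_mem (add_mem (algebraMap_mem _ _) (mul_mem (algebraMap_mem _ _) hθmem))
        (mul_mem (algebraMap_mem _ _) (pow_mem hθmem 2))
    · rw [IntermediateField.adjoin_simple_le_iff]
      have hθeq : θ = algebraMap ℚ (AlgebraicClosure ℚ) (-25232812769127/492640816 : ℚ) +
          algebraMap ℚ (AlgebraicClosure ℚ) (-82130073/123160204 : ℚ) * β +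
          algebraMap ℚ (AlgebraicClosure ℚ) (8555/492640816 : ℚ) * β ^ 2 := by
        rw [hβdef]; simp only [eq_ratCast]; push_cast
        linear_combination (((-1057347397175 : AlgebraicClosure ℚ) / 123160204) + ((-626123553875 : AlgebraicClosure ℚ) / 123160204) * θ) * hθ'
      rw [hθeq]
      have hβmem := IntermediateField.mem_adjoin_simple_self ℚ β
      exact add_mem (add_mem (algebraMap_mem _ _) (mul_mem (algebraMap_mem _ _) hβmem))
        (mul_mem (algebraMap_mem _ _) (pow_mem hβmem 2))
  obtain ⟨P₀, hP₀, hP₀eq⟩ := exists_geomTorsion_two_eq_some_root ((1 : ℤ) : ℚ) ((-4424231585 : ℤ) : ℚ)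
    ((-113268864408513 : ℤ) : ℚ) hβ
  have hF : IntermediateField.fixedField (MulAction.stabilizer (absoluteGaloisGroup ℚ) P₀) =
      IntermediateField.adjoin ℚ {θ} := by
    rw [fixedField_stabilizer_eq_adjoin_root _ _ _ hβ hP₀eq, ← hadj]
    -- the two `Algebra ℚ ℚ̄` instance paths agree
    congr 1
  -- the even-index certificate in `𝓞 ℚ(θ)`
  have hirr := irreducible_cubic_d804n
  haveI : FiniteDimensional ℚ (IntermediateField.adjoin ℚ {θ}) :=
    IntermediateField.adjoin.finiteDimensional ((AlgebraicClosure.isAlgebraic ℚ).isAlgebraic θ).isIntegral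
  haveI : NumberField (IntermediateField.adjoin ℚ {θ}) := NumberField.mk
  obtain ⟨B, -, hB⟩ := exists_ringOfIntegers_cubic_root (p := -1) (q := 4) (r := -6) hθ
  have h3 := finrank_adjoin_eq_three_of_irreducible hirr hθ
  refine fineSelmerDual_moduleFinite_two_of_evenIndexCertificate_pointField hLim2 _ hP₀ (p := -1) (q := 4) (r := -6) hirr hθ hF
    (((-2 : ℤ) : 𝓞 (IntermediateField.adjoin ℚ {θ})) + ((-2 : ℤ) : 𝓞 (IntermediateField.adjoin ℚ {θ})) * B + ((0 : ℤ) : 𝓞 (IntermediateField.adjoin ℚ {θ})) * B ^ 2) (((0 : ℤ) : 𝓞 (IntermediateField.adjoin ℚ {θ})) + ((-1 : ℤ) : 𝓞 (IntermediateField.adjoin ℚ {θ})) * B + ((-1 : ℤ) : 𝓞 (IntermediateField.adjoin ℚ {θ})) * B ^ 2) (((-8 : ℤ) : 𝓞 (IntermediateField.adjoin ℚ {θ})) + ((5 : ℤ) : 𝓞 (IntermediateField.adjoin ℚ {θ})) * B + ((1 : ℤ) : 𝓞 (IntermediateField.adjoin ℚ {θ})) * B ^ 2) (((65 : ℤ)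 : 𝓞 (IntermediateField.adjoin ℚ {θ})) + ((-59 : ℤ) : 𝓞 (IntermediateField.adjoin ℚ {θ})) * B + ((8 : ℤ) : 𝓞 (IntermediateField.adjoin ℚ {θ})) * B ^ 2) ?_ ?_ ?_
    (by rw [card_classGroup_adjoin_eq_one_disc_neg804 hθ]; norm_num) h1 κ hκ
  · push_cast; linear_combination (((-6 : ℤ) : 𝓞 (IntermediateField.adjoin ℚ {θ})) + ((-2 : ℤ) : 𝓞 (IntermediateField.adjoin ℚ {θ})) * B) * hB
  · push_cast; linear_combination (((11 : ℤ) : 𝓞 (IntermediateField.adjoin ℚ {θ})) + ((1 : ℤ) : 𝓞 (IntermediateField.adjoin ℚ {θ})) * B) * hB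
  · have hz : (2 : 𝓞 (IntermediateField.adjoin ℚ {θ})) - (((65 : ℤ) : 𝓞 (IntermediateField.adjoin ℚ {θ})) + ((-59 : ℤ) : 𝓞 (IntermediateField.adjoin ℚ {θ})) * B + ((8 : ℤ) : 𝓞 (IntermediateField.adjoin ℚ {θ})) * B ^ 2) ^ 3 =
        ((1285155 : ℤ) : 𝓞 (IntermediateField.adjoin ℚ {θ})) + (-790987 : ℤ) * B + (-122696 : ℤ) * B ^ 2 := by
      push_cast; linear_combination (((259963 : ℤ) : 𝓞 (IntermediateField.adjoin ℚ {θ})) + ((-83160 : ℤ) : 𝓞 (IntermediateField.adjoin ℚ {θ})) * B + ((10816 : ℤ) : 𝓞 (IntermediateField.adjoin ℚ {θ})) * B ^ 2 + ((-512 : ℤ) : 𝓞 (IntermediateField.adjoin ℚ {θ})) * B ^ 3) * hB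
    rw [hz]
    exact not_eight_dvd_norm_coords _ h3 B hirr hB (1285155) (-790987) (-122696) (N := 12649572874794)
      (by simp only [Matrix.one_fin_three, Matrix.det_fin_three, Matrix.add_apply, Matrix.smul_apply, sq, Matrix.mul_apply,
        Fin.sum_univ_three, Matrix.of_apply, Matrix.cons_val', Matrix.cons_val_zero, Matrix.cons_val_one, Matrix.cons_val_two,
        Matrix.head_cons, Matrix.tail_cons, Matrix.empty_val', Matrix.cons_val_fin_one, smul_eq_mul]; norm_num) (by norm_num)

/-- The census curve `434964b1` is an elliptic curve. -/
theorem isElliptic_434964b1' : (⟨0, ((-1 : ℤ) : ℚ), 0, ((-23349300 : ℤ) : ℚ), ((-43419126312 : ℤ) : ℚ)⟩ : WeierstrassCurve ℚ).IsElliptic :=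
  isElliptic_cubicModel _ _ _ (by simp only [Cubic.discr]; norm_num)

/-- **(A)₂ for `434964b1` from ONE parity bit** (a `C1″-RES` row of GEN 4's census: `2 = 𝔭²𝔮` in `ℚ(P)`, `d = -804`). Granted `hLim2`;
displayed: «`e_1 = 0` along the cyclotomic `ℤ₂`-extensions of `ℚ(θ)`» = `2 ∤ h(ℚ(θ, √2))` (census `cyc6 = []`); `h(ℚ(θ)) = 1` by the kernel certificate `card_classGroup_adjoin_eq_one_disc_neg804`.
`θ` is any root of `X³ + (-1)X² + (4)X + (-6)`; KERNEL: `ℚ(P) = ℚ(β) = ℚ(θ)` (`β = 2758 + (428)θ + (1243)θ²` is a root of the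
`2`-division cubic), Fukuda's index `0` by the EVEN-INDEX CERTIFICATE `u = [-2, -2, 0]`, `v = [0, -1, -1]`, `m = [-8, 5, 1]`, `m' = [65, -59, 8]`
(coordinates in `1, θ, θ²`; `N(2 − m'³) = 12649572874794`, `8 ∤`), Fukuda Thm. 1 (1).
[cite: Lim2017FineSelmer, §3 Thm. 3.5 and Lemma 3.2] [cite: Fukuda1994, Thm. 1 (1), p. 264] -/
theorem conjA_two_434964b1_of_layerOneBit
    (hLim2 : Lim2017.thm35_at_two_fineSelmerDual_moduleFinite_of_classicalMuVanishes_of_le_divisionField_four)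
    {θ : AlgebraicClosure ℚ} (hθ : aeval θ (Cubic.toPoly ⟨1, ((-1 : ℤ) : ℚ), ((4 : ℤ) : ℚ), ((-6 : ℤ) : ℚ)⟩) = 0)
    (h1 : haveI : FiniteDimensional ℚ (IntermediateField.adjoin ℚ {θ}) :=
        IntermediateField.adjoin.finiteDimensional ((AlgebraicClosure.isAlgebraic ℚ).isAlgebraic θ).isIntegral
      haveI : NumberField (IntermediateField.adjoin ℚ {θ}) := NumberField.mk
      ∀ κL : ZpExtension (IntermediateField.adjoin ℚ {θ}) 2, κL.IsCyclotomic → classNumberPExp κL 1 = 0)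
    (κ : ZpExtension ℚ 2) (hκ : κ.IsCyclotomic) :
    haveI := isElliptic_434964b1'
    ∃ (γ : absoluteGaloisGroup ℚ) (D : (⟨0, ((-1 : ℤ) : ℚ), 0, ((-23349300 : ℤ) : ℚ), ((-43419126312 : ℤ) : ℚ)⟩ : WeierstrassCurve ℚ).FineSelmerDualData κ γ),
      Module.Finite ℤ_[2] (RestrictScalars ℤ_[2] (IwasawaAlgebra 2) D.X) := by
  haveI := isElliptic_434964b1'
  have hθ' : θ ^ 3 + (-1 : AlgebraicClosure ℚ) * θ ^ 2 + (4 : AlgebraicClosure ℚ) * θ + (-6 : AlgebraicClosure ℚ) = 0 := by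
    have := hθ
    simp only [Cubic.toPoly, map_one, one_mul, aeval_add, aeval_mul, aeval_C, aeval_X_pow, aeval_X,
      eq_ratCast, Rat.cast_intCast] at this
    push_cast at this
    linear_combination this
  set β : AlgebraicClosure ℚ := algebraMap ℚ (AlgebraicClosure ℚ) (2758 : ℚ) +
      algebraMap ℚ (AlgebraicClosure ℚ) (428 : ℚ) * θ + algebraMap ℚ (AlgebraicClosure ℚ) (1243 : ℚ) * θ ^ 2 with hβdef
  have hβ : aeval β (Cubic.toPoly ⟨1, ((-1 : ℤ) : ℚ), ((-23349300 : ℤ) : ℚ), ((-43419126312 : ℤ) : ℚ)⟩) = 0 := by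
    simp only [Cubic.toPoly, map_one, one_mul, aeval_add, aeval_mul, aeval_C, aeval_X_pow, aeval_X, eq_ratCast,
      Rat.cast_intCast]
    rw [hβdef]
    simp only [eq_ratCast]
    push_cast
    linear_combination ((14474199794 : AlgebraicClosure ℚ) + (9687638708 : AlgebraicClosure ℚ) * θ + (3904338823 : AlgebraicClosure ℚ) * θ ^ 2 + (1920495907 : AlgebraicClosure ℚ) * θ ^ 3) * hθ'
  have hadj : IntermediateField.adjoin ℚ {β} = IntermediateField.adjoin ℚ {θ} := by
    apply le_antisymm
    · rw [IntermediateField.adjoin_simple_le_iff, hβdef]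
      have hθmem := IntermediateField.mem_adjoin_simple_self ℚ θ
      exact add_mem (add_mem (algebraMap_mem _ _) (mul_mem (algebraMap_mem _ _) hθmem))
        (mul_mem (algebraMap_mem _ _) (pow_mem hθmem 2))
    · rw [IntermediateField.adjoin_simple_le_iff]
      have hθeq : θ = algebraMap ℚ (AlgebraicClosure ℚ) (-3224561324/131463 : ℚ) +
          algebraMap ℚ (AlgebraicClosure ℚ) (-3468433/788778 : ℚ) * β +
          algebraMap ℚ (AlgebraicClosure ℚ) (1243/788778 : ℚ) * β ^ 2 := by
        rw [hβdef]; simp only [eq_ratCast]; push_cast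
        linear_combination (((-3243057851 : AlgebraicClosure ℚ) / 788778) + ((-1920495907 : AlgebraicClosure ℚ) / 788778) * θ) * hθ'
      rw [hθeq]
      have hβmem := IntermediateField.mem_adjoin_simple_self ℚ β
      exact add_mem (add_mem (algebraMap_mem _ _) (mul_mem (algebraMap_mem _ _) hβmem))
        (mul_mem (algebraMap_mem _ _) (pow_mem hβmem 2))
  obtain ⟨P₀, hP₀, hP₀eq⟩ := exists_geomTorsion_two_eq_some_root ((-1 : ℤ) : ℚ) ((-23349300 : ℤ) : ℚ)
    ((-43419126312 : ℤ) : ℚ) hβ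
  have hF : IntermediateField.fixedField (MulAction.stabilizer (absoluteGaloisGroup ℚ) P₀) =
      IntermediateField.adjoin ℚ {θ} := by
    rw [fixedField_stabilizer_eq_adjoin_root _ _ _ hβ hP₀eq, ← hadj]
    -- the two `Algebra ℚ ℚ̄` instance paths agree
    congr 1
  -- the even-index certificate in `𝓞 ℚ(θ)`
  have hirr := irreducible_cubic_d804n
  haveI : FiniteDimensional ℚ (IntermediateField.adjoin ℚ {θ}) :=
    IntermediateField.adjoin.finiteDimensional ((AlgebraicClosure.isAlgebraic ℚ).isAlgebraic θ).isIntegral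
  haveI : NumberField (IntermediateField.adjoin ℚ {θ}) := NumberField.mk
  obtain ⟨B, -, hB⟩ := exists_ringOfIntegers_cubic_root (p := -1) (q := 4) (r := -6) hθ
  have h3 := finrank_adjoin_eq_three_of_irreducible hirr hθ
  refine fineSelmerDual_moduleFinite_two_of_evenIndexCertificate_pointField hLim2 _ hP₀ (p := -1) (q := 4) (r := -6) hirr hθ hF
    (((-2 : ℤ) : 𝓞 (IntermediateField.adjoin ℚ {θ})) + ((-2 : ℤ) : 𝓞 (IntermediateField.adjoin ℚ {θ})) * B + ((0 : ℤ) : 𝓞 (IntermediateField.adjoin ℚ {θ})) * B ^ 2) (((0 : ℤ) : 𝓞 (IntermediateField.adjoin ℚ {θ})) + ((-1 : ℤ) : 𝓞 (IntermediateField.adjoin ℚ {θ})) * B + ((-1 : ℤ) : 𝓞 (IntermediateField.adjoin ℚ {θ})) * B ^ 2) (((-8 : ℤ) : 𝓞 (IntermediateField.adjoin ℚ {θ})) + ((5 : ℤ) : 𝓞 (IntermediateField.adjoin ℚ {θ})) * B + ((1 : ℤ) : 𝓞 (IntermediateField.adjoin ℚ {θ})) * B ^ 2) (((65 : ℤ)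 : 𝓞 (IntermediateField.adjoin ℚ {θ})) + ((-59 : ℤ) : 𝓞 (IntermediateField.adjoin ℚ {θ})) * B + ((8 : ℤ) : 𝓞 (IntermediateField.adjoin ℚ {θ})) * B ^ 2) ?_ ?_ ?_
    (by rw [card_classGroup_adjoin_eq_one_disc_neg804 hθ]; norm_num) h1 κ hκ
  · push_cast; linear_combination (((-6 : ℤ) : 𝓞 (IntermediateField.adjoin ℚ {θ})) + ((-2 : ℤ) : 𝓞 (IntermediateField.adjoin ℚ {θ})) * B) * hB
  · push_cast; linear_combination (((11 : ℤ) : 𝓞 (IntermediateField.adjoin ℚ {θ})) + ((1 : ℤ) : 𝓞 (IntermediateField.adjoin ℚ {θ})) * B) * hB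
  · have hz : (2 : 𝓞 (IntermediateField.adjoin ℚ {θ})) - (((65 : ℤ) : 𝓞 (IntermediateField.adjoin ℚ {θ})) + ((-59 : ℤ) : 𝓞 (IntermediateField.adjoin ℚ {θ})) * B + ((8 : ℤ) : 𝓞 (IntermediateField.adjoin ℚ {θ})) * B ^ 2) ^ 3 =
        ((1285155 : ℤ) : 𝓞 (IntermediateField.adjoin ℚ {θ})) + (-790987 : ℤ) * B + (-122696 : ℤ) * B ^ 2 := by
      push_cast; linear_combination (((259963 : ℤ) : 𝓞 (IntermediateField.adjoin ℚ {θ})) + ((-83160 : ℤ) : 𝓞 (IntermediateField.adjoin ℚ {θ})) * B + ((10816 : ℤ) : 𝓞 (IntermediateField.adjoin ℚ {θ})) * B ^ 2 + ((-512 : ℤ) : 𝓞 (IntermediateField.adjoin ℚ {θ})) * B ^ 3) * hB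
    rw [hz]
    exact not_eight_dvd_norm_coords _ h3 B hirr hB (1285155) (-790987) (-122696) (N := 12649572874794)
      (by simp only [Matrix.one_fin_three, Matrix.det_fin_three, Matrix.add_apply, Matrix.smul_apply, sq, Matrix.mul_apply,
        Fin.sum_univ_three, Matrix.of_apply, Matrix.cons_val', Matrix.cons_val_zero, Matrix.cons_val_one, Matrix.cons_val_two,
        Matrix.head_cons, Matrix.tail_cons, Matrix.empty_val', Matrix.cons_val_fin_one, smul_eq_mul]; norm_num) (by norm_num)

end Summit.BirchSwinnertonDyer.BirchSwinnertonDyer.Theorems.AddKatoTwo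

end
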